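import Literature.Probability.LatticeModels.SHolomorphicPrimitive
import Literature.Probability.LatticeModels.LatticeLaplacian
import HarnessLib

/-!
# s-holomorphicity implies discrete Cauchy–Riemann: harmonicity on the sublattices and the discrete Cauchy theorem

Topic `Literature/Probability/LatticeModels`; an instalment (item G0(ii) of the road recorded in
`Sweep1Proofs.lean`, module docstring §2b) of the discharge programme for crit-ising.S18 /
Smirnov's Theorem 2.2. S. Smirnov, *Conformal invariance in random cluster models. I*, Ann. of
Math. 172 (2010), Remark 3.3: "It is easy to check that our property [s-holomorphicity,
Def. 3.1] implies the more common one [the discrete Cauchy–Riemann equation (3.2),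
`F(NW) - F(SE) = i (F(NE) - F(SW))` around every lattice square] on vertices". This file checks
it for the tree's objects (`IsSHolAt` of `SHolomorphicPrimitive.lean`, corners coded as
`(v, k)` with edges `cSrc`, `cTgt`) and draws the two classical consequences used in §5 of the
paper: discrete holomorphic functions are discrete harmonic on each of the two sublattices of
the medial lattice (R. J. Duffin, Duke Math. J. 23 (1956)), and their discrete contour sums around
lattice rectangles vanish. Everything is proved.

* `isSHolAt_iff_re`: s-holomorphicity across the corner `(v, k)` is the real-linear equation
  `Re(X (1+i)^k) = Re(Y (1+i)^k)` in the frame coordinates of `SHolomorphicPrimitive.lean`.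
* `cr_vertex`, `cr_face` (`CRVertex`, `CRFace`): s-holomorphicity across the four corners of a
  vertex (resp. of a face) implies `F(N) - F(S) = i (F(E) - F(W))` for its four edges (sides) —
  linear algebra on the four real equations.
* `sum_edgeFun_zero_sub`, `sum_edgeFun_one_sub`: the values on the horizontal (resp. vertical)
  edges, `edgeFun F 0` (resp. `edgeFun F 1`), a function on a copy of `ℤ²`, satisfy the five-point
  identity `∑_k G(v + e_k) - 4 G(v) = 0` wherever the Cauchy–Riemann equations hold at the two
  endpoints and the two adjacent faces of the edge; `latticeLaplacian_re_im_eq_zero` turns this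
  into `IsLatticeHarmonicOn` statements for the real and imaginary parts (`LatticeLaplacian.lean`).
* `norm_sub_le_of_isSHolAt`: the vertical values are controlled by the horizontal ones,
  `‖F(n) - F(h)‖ ≤ ‖F(w) - F(h)‖` for the north edge `n`, east edge `h` and north-west edge `w` at
  a vertex, by the orthogonality of the lines of the two corners at `n`
  (`norm_projLine_sq_add_two`).
* `sum_crDefect_eq_boundary` (**discrete Green formula**, valid for every `F`): on the rectangle of
  vertices `vtx b i j = b + i e₀ + j e₁`, `0 ≤ i ≤ m`, `0 ≤ j ≤ n`, the sum of the Cauchy–Riemann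
  defects over its vertices and faces telescopes to the contour sum of `F` over the medial
  vertices along the boundary (edges on the sides and the half-edges sticking out, weights
  `1, i, -1, -i`); `boundary_sum_eq_zero_of_cr` (**discrete Cauchy theorem**): it vanishes when
  the Cauchy–Riemann equations hold there. In the continuum limit the contour sum divided by
  `√δ` is a Riemann sum of `∮ F dz`, which is how Morera's theorem will identify subsequential
  limits of `F/√δ` as holomorphic (§5 of the paper, "`F_j/√δ_j` … limit is holomorphic").

## References

* S. Smirnov, Ann. of Math. 172 (2010) 1435–1467, Def. 3.1, Remark 3.3, §5 — bib key `Smirnov2010`.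
* R. J. Duffin, *Basic properties of discrete analytic functions*, Duke Math. J. 23 (1956) 335–363.
-/

noncomputable section

namespace Literature.Probability.LatticeModels

open Finset Complex ComplexConjugate

/-! ### s-holomorphicity across a corner, in frame coordinates -/

/-- `IsSHolAt F (v, k)` in the frame at `v₀`: `Re(X (1+i)^k) = Re(Y (1+i)^k)` for the frame
coordinates `X, Y` of `F` at the source and target edges. [cite: Smirnov2010, Def. 3.1] -/
theorem isSHolAt_iff_re (v₀ : Site 2) (F : MedialVertex → ℂ) (v : Site 2) (k : Fin 4) :
    IsSHolAt F (v, k) ↔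
      (frameCoord v₀ (F (cSrc (v, k))) * (1 + I) ^ (k : ℕ)).re =
        (frameCoord v₀ (F (cTgt (v, k))) * (1 + I) ^ (k : ℕ)).re :=
  projLine_cornerLine_eq_iff v₀ v k (Nat.mod_eq_of_lt k.isLt) _ _

/-- The frame coordinate map is injective (`conj η₀ ≠ 0`). [folklore] -/
theorem frameCoord_injective (v₀ : Site 2) : Function.Injective (frameCoord v₀) := by
  intro X Y h
  have hc : conj (frameVec v₀) ≠ 0 := by
    rw [map_ne_zero_iff _ (RingHom.injective _)]; exact frameVec_ne_zero v₀
  exact mul_right_cancel₀ hc h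

/-- The frame coordinate commutes with multiplication by `i`. [folklore] -/
theorem frameCoord_I_mul (v₀ : Site 2) (X : ℂ) : frameCoord v₀ (I * X) = I * frameCoord v₀ X := by
  unfold frameCoord; ring

/-! ### The discrete Cauchy–Riemann equations at a vertex and at a face -/

/-- **s-holomorphicity implies the Cauchy–Riemann equation at a vertex** (Smirnov 2010,
Remark 3.3: "our property implies the more common one on vertices"). If `F` is s-holomorphic across
the four corners `(v, k)` of the vertex `v`, then with `E, N, W, S` the four edges of `v`
(`cSrc (v, k)`, `k = 0, 1, 2, 3`): `F(N) - F(S) = i (F(E) - F(W))`. [cite: Smirnov2010, Remark 3.3] -/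
theorem cr_vertex {F : MedialVertex → ℂ} {v : Site 2} (h0 : IsSHolAt F (v, 0)) (h1 : IsSHolAt F (v, 1))
    (h2 : IsSHolAt F (v, 2)) (h3 : IsSHolAt F (v, 3)) :
    F (cSrc (v, 1)) - F (cSrc (v, 3)) = I * (F (cSrc (v, 0)) - F (cSrc (v, 2))) := by
  rw [isSHolAt_iff_re v] at h0 h1 h2 h3
  -- targets are the next sources
  rw [show cTgt (v, (0 : Fin 4)) = cSrc (v, 1) from rfl] at h0
  rw [show cTgt (v, (1 : Fin 4)) = cSrc (v, 2) from rfl] at h1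
  rw [show cTgt (v, (2 : Fin 4)) = cSrc (v, 3) from rfl] at h2
  rw [show cTgt (v, (3 : Fin 4)) = cSrc (v, 0) from cTgt_add_three v 0] at h3
  apply frameCoord_injective v
  rw [frameCoord_sub, frameCoord_I_mul, frameCoord_sub]
  set Y0 := frameCoord v (F (cSrc (v, 0)))
  set Y1 := frameCoord v (F (cSrc (v, 1)))
  set Y2 := frameCoord v (F (cSrc (v, 2)))
  set Y3 := frameCoord v (F (cSrc (v, 3)))
  simp only [Fin.val_zero, pow_zero, mul_one, Fin.val_one, pow_one, Fin.val_two] at h0 h1 h2 h3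
  have e3 : ((3 : Fin 4) : ℕ) = 3 := rfl
  rw [e3] at h3
  have p2 : (1 + I) ^ 2 = 2 * I := one_add_I_sq
  have p3 : (1 + I) ^ 3 = -2 + 2 * I := one_add_I_pow_three
  rw [p2] at h2
  rw [p3] at h3
  simp only [mul_re, add_re, one_re, I_re, add_im, one_im, I_im, mul_im, re_ofNat, im_ofNat,
    neg_re, neg_im] at h0 h1 h2 h3
  apply Complex.ext <;> simp <;> linarith

/-- **s-holomorphicity implies the Cauchy–Riemann equation at a face.** If `F` is s-holomorphic
across the four corners `(f + cornerOff j, j)` of the face `f`, then with `S, E, N, W` its four sides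
(`cSrc (f + cornerOff j, j)`, `j = 0, 1, 2, 3`): `F(N) - F(S) = i (F(E) - F(W))`.
[cite: Smirnov2010, Remark 3.3] -/
theorem cr_face {F : MedialVertex → ℂ} {f : Site 2} (h0 : IsSHolAt F (f + cornerOff 0, 0))
    (h1 : IsSHolAt F (f + cornerOff 1, 1)) (h2 : IsSHolAt F (f + cornerOff 2, 2))
    (h3 : IsSHolAt F (f + cornerOff 3, 3)) :
    F (cSrc (f + cornerOff 2, 2)) - F (cSrc (f + cornerOff 0, 0)) =
      I * (F (cSrc (f + cornerOff 1, 1)) - F (cSrc (f + cornerOff 3, 3))) := by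
  rw [isSHolAt_iff_re f] at h0 h1 h2 h3
  rw [cTgt_face_corner f (show (3 : Fin 4) = 0 + 3 from rfl)] at h0
  rw [cTgt_face_corner f (show (0 : Fin 4) = 1 + 3 from rfl)] at h1
  rw [cTgt_face_corner f (show (1 : Fin 4) = 2 + 3 from rfl)] at h2
  rw [cTgt_face_corner f (show (2 : Fin 4) = 3 + 3 from rfl)] at h3
  apply frameCoord_injective f
  rw [frameCoord_sub, frameCoord_I_mul, frameCoord_sub]
  set Z0 := frameCoord f (F (cSrc (f + cornerOff 0, 0)))
  set Z1 := frameCoord f (F (cSrc (f + cornerOff 1, 1)))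
  set Z2 := frameCoord f (F (cSrc (f + cornerOff 2, 2)))
  set Z3 := frameCoord f (F (cSrc (f + cornerOff 3, 3)))
  simp only [Fin.val_zero, pow_zero, mul_one, Fin.val_one, pow_one, Fin.val_two] at h0 h1 h2 h3
  have e3 : ((3 : Fin 4) : ℕ) = 3 := rfl
  rw [e3] at h3
  have p2 : (1 + I) ^ 2 = 2 * I := one_add_I_sq
  have p3 : (1 + I) ^ 3 = -2 + 2 * I := one_add_I_pow_three
  rw [p2] at h2
  rw [p3] at h3
  simp only [mul_re, add_re, one_re, I_re, add_im, one_im, I_im, mul_im, re_ofNat, im_ofNat,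
    neg_re, neg_im] at h0 h1 h2 h3
  apply Complex.ext <;> simp <;> linarith

/-! ### The Cauchy–Riemann predicates -/

/-- The **discrete Cauchy–Riemann equation at the vertex `v`**: `F(N) - F(S) = i (F(E) - F(W))` for
its four edges `E, N, W, S = cSrc (v, 0), …, cSrc (v, 3)`. [cite: Smirnov2010, Remark 3.3 eq. (3.2)] -/
def CRVertex (F : MedialVertex → ℂ) (v : Site 2) : Prop :=
  F (cSrc (v, 1)) - F (cSrc (v, 3)) = I * (F (cSrc (v, 0)) - F (cSrc (v, 2)))

/-- The **discrete Cauchy–Riemann equation at the face `f`**: `F(N) - F(S) = i (F(E) - F(W))` for its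
four sides `S, E, N, W = cSrc (f + cornerOff j, j)`, `j = 0, 1, 2, 3`.
[cite: Smirnov2010, Remark 3.3 eq. (3.2)] -/
def CRFace (F : MedialVertex → ℂ) (f : Site 2) : Prop :=
  F (cSrc (f + cornerOff 2, 2)) - F (cSrc (f + cornerOff 0, 0)) =
    I * (F (cSrc (f + cornerOff 1, 1)) - F (cSrc (f + cornerOff 3, 3)))

/-- s-holomorphicity at the four corners of a vertex gives `CRVertex`. [cite: Smirnov2010, Remark 3.3] -/
theorem crVertex_of_isSHolAt {F : MedialVertex → ℂ} {v : Site 2} (h : ∀ k : Fin 4, IsSHolAt F (v, k)) :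
    CRVertex F v :=
  cr_vertex (h 0) (h 1) (h 2) (h 3)

/-- s-holomorphicity at the four corners of a face gives `CRFace`. [cite: Smirnov2010, Remark 3.3] -/
theorem crFace_of_isSHolAt {F : MedialVertex → ℂ} {f : Site 2} (h : ∀ j : Fin 4, IsSHolAt F (f + cornerOff j, j)) :
    CRFace F f :=
  cr_face (h 0) (h 1) (h 2) (h 3)

/-! ### Edge bookkeeping -/

/-- `F` read on the edges in direction `k`: `u ↦ F (s(u, u + e_k))`. For `k = 0` these are the
horizontal edges (a copy of `ℤ²`), for `k = 1` the vertical ones. [folklore] -/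
def edgeFun (F : MedialVertex → ℂ) (k : Fin 4) (u : Site 2) : ℂ := F (cSrc (u, k))

/-- `cornerOff 0 = 0`. [folklore] -/
private theorem cornerOff_zero : cornerOff 0 = 0 := rfl
/-- `cornerOff 1 = e₀`. [folklore] -/
private theorem cornerOff_one : cornerOff 1 = cornerUnit 0 := rfl
/-- `cornerOff 3 = e₁`. [folklore] -/
private theorem cornerOff_three : cornerOff 3 = cornerUnit 1 := rfl
/-- `cornerOff 2 = e₀ + e₁`. [folklore] -/
private theorem cornerOff_two : cornerOff 2 = cornerUnit 0 + cornerUnit 1 := rfl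

/-- The west edge of `v` is the east edge of `v - e₀`. [folklore] -/
theorem cSrc_two (v : Site 2) : cSrc (v, 2) = cSrc (v - cornerUnit 0, 0) := by
  have := cSrc_add_cornerUnit_add_two (v - cornerUnit 0) 0
  rwa [sub_add_cancel] at this

/-- The south edge of `v` is the north edge of `v - e₁`. [folklore] -/
theorem cSrc_three (v : Site 2) : cSrc (v, 3) = cSrc (v - cornerUnit 1, 1) := by
  have := cSrc_add_cornerUnit_add_two (v - cornerUnit 1) 1
  rwa [sub_add_cancel] at this

/-- The top side of the face `f`: `cSrc (f + cornerOff 2, 2) = cSrc (f + e₁, 0)`. [folklore] -/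
theorem cSrc_face_two (f : Site 2) : cSrc (f + cornerOff 2, 2) = cSrc (f + cornerUnit 1, 0) := by
  rw [cornerOff_two, show f + (cornerUnit 0 + cornerUnit 1) = f + cornerUnit 1 + cornerUnit 0 by abel,
    show (2 : Fin 4) = 0 + 2 from rfl, cSrc_add_cornerUnit_add_two]

/-- The left side of the face `f`: `cSrc (f + cornerOff 3, 3) = cSrc (f, 1)`. [folklore] -/
theorem cSrc_face_three (f : Site 2) : cSrc (f + cornerOff 3, 3) = cSrc (f, 1) := by
  rw [cornerOff_three, show (3 : Fin 4) = 1 + 2 from rfl, cSrc_add_cornerUnit_add_two]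

/-- The right side of the face `f`: `cSrc (f + cornerOff 1, 1) = cSrc (f + e₀, 1)`. [folklore] -/
theorem cSrc_face_one (f : Site 2) : cSrc (f + cornerOff 1, 1) = cSrc (f + cornerUnit 0, 1) := by
  rw [cornerOff_one]

/-- The bottom side of the face `f`: `cSrc (f + cornerOff 0, 0) = cSrc (f, 0)`. [folklore] -/
theorem cSrc_face_zero (f : Site 2) : cSrc (f + cornerOff 0, 0) = cSrc (f, 0) := by
  rw [cornerOff_zero, add_zero]

/-- `CRVertex` unfolded on the edge functions: `V(v) - V(v - e₁) = i (H(v) - H(v - e₀))`. [folklore] -/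
theorem crVertex_iff (F : MedialVertex → ℂ) (v : Site 2) :
    CRVertex F v ↔ edgeFun F 1 v - edgeFun F 1 (v - cornerUnit 1) = I * (edgeFun F 0 v - edgeFun F 0 (v - cornerUnit 0)) := by
  unfold CRVertex edgeFun
  rw [cSrc_two, cSrc_three]

/-- `CRFace` unfolded on the edge functions: `H(f + e₁) - H(f) = i (V(f + e₀) - V(f))`. [folklore] -/
theorem crFace_iff (F : MedialVertex → ℂ) (f : Site 2) :
    CRFace F f ↔ edgeFun F 0 (f + cornerUnit 1) - edgeFun F 0 f = I * (edgeFun F 1 (f + cornerUnit 0) - edgeFun F 1 f) := by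
  unfold CRFace edgeFun
  rw [cSrc_face_two, cSrc_face_zero, cSrc_face_one, cSrc_face_three]

/-! ### Harmonicity on the two sublattices (Duffin) -/

/-- **The horizontal edge values are discrete harmonic.** From the Cauchy–Riemann equations at the
two endpoints `v, v + e₀` of a horizontal edge and at the two faces `v`, `v - e₁` above and below
it: `∑_k H(v + e_k) - 4 H(v) = 0`, `H = edgeFun F 0` (the classical fact that a discrete holomorphic
function is discrete harmonic on each sublattice; Smirnov 2010, §3 / Duffin 1956).
[cite: Smirnov2010, Remark 3.3] -/
theorem sum_edgeFun_zero_sub {F : MedialVertex → ℂ} {v : Site 2} (hv : CRVertex F v)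
    (hv' : CRVertex F (v + cornerUnit 0)) (hf : CRFace F v) (hg : CRFace F (v - cornerUnit 1)) :
    (∑ k : Fin 4, edgeFun F 0 (v + cornerUnit k)) - 4 * edgeFun F 0 v = 0 := by
  rw [crVertex_iff] at hv hv'
  rw [crFace_iff] at hf hg
  rw [add_sub_cancel_right] at hv'
  rw [sub_add_cancel, show v - cornerUnit 1 + cornerUnit 0 = v + cornerUnit 0 - cornerUnit 1 by abel] at hg
  rw [Fin.sum_univ_four, show v + cornerUnit 2 = v - cornerUnit 0 by
      rw [show (2 : Fin 4) = 0 + 2 from rfl, cornerUnit_add_two, sub_eq_add_neg],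
    show v + cornerUnit 3 = v - cornerUnit 1 by
      rw [show (3 : Fin 4) = 1 + 2 from rfl, cornerUnit_add_two, sub_eq_add_neg]]
  linear_combination (norm := skip) (-I) * hv + I * hv' + hf - hg
  ring_nf
  rw [I_sq]
  ring

/-- **The vertical edge values are discrete harmonic**: `∑_k V(v + e_k) - 4 V(v) = 0`,
`V = edgeFun F 1`, from the Cauchy–Riemann equations at `v`, `v + e₁` and at the faces `v`, `v - e₀`
right and left of the edge. [cite: Smirnov2010, Remark 3.3] -/
theorem sum_edgeFun_one_sub {F : MedialVertex → ℂ} {v : Site 2} (hv : CRVertex F v)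
    (hv' : CRVertex F (v + cornerUnit 1)) (hf : CRFace F v) (hg : CRFace F (v - cornerUnit 0)) :
    (∑ k : Fin 4, edgeFun F 1 (v + cornerUnit k)) - 4 * edgeFun F 1 v = 0 := by
  rw [crVertex_iff] at hv hv'
  rw [crFace_iff] at hf hg
  rw [add_sub_cancel_right] at hv'
  rw [sub_add_cancel, show v - cornerUnit 0 + cornerUnit 1 = v + cornerUnit 1 - cornerUnit 0 by abel] at hg
  rw [Fin.sum_univ_four, show v + cornerUnit 2 = v - cornerUnit 0 by
      rw [show (2 : Fin 4) = 0 + 2 from rfl, cornerUnit_add_two, sub_eq_add_neg],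
    show v + cornerUnit 3 = v - cornerUnit 1 by
      rw [show (3 : Fin 4) = 1 + 2 from rfl, cornerUnit_add_two, sub_eq_add_neg]]
  linear_combination (norm := skip) hv' - hv + I * hf + (-I) * hg
  ring_nf
  rw [I_sq]
  ring

/-- Real and imaginary parts of the edge functions are lattice-harmonic wherever the five-point
identity holds. [folklore] -/
theorem latticeLaplacian_re_im_eq_zero {G : Site 2 → ℂ} {v : Site 2}
    (h : (∑ k : Fin 4, G (v + cornerUnit k)) - 4 * G v = 0) :
    latticeLaplacian (fun u => (G u).re) v = 0 ∧ latticeLaplacian (fun u => (G u).im) v = 0 := by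
  have hre := congrArg Complex.re h
  have him := congrArg Complex.im h
  simp only [sub_re, re_sum, mul_re, sub_im, im_sum, mul_im, zero_re, zero_im] at hre him
  norm_num at hre him
  rw [latticeLaplacian_eq, latticeLaplacian_eq]
  exact ⟨by linarith, by linarith⟩

/-! ### Passing between the two sublattices -/

/-- The projection onto a line is additive. [folklore] -/
theorem projLine_sub (η X Y : ℂ) : projLine η (X - Y) = projLine η X - projLine η Y := by
  unfold projLine; exact map_sub _ X Y

/-- The projection onto a line does not increase norms. [folklore] -/
theorem norm_projLine_le (η X : ℂ) : ‖projLine η X‖ ≤ ‖X‖ := by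
  unfold projLine; exact Submodule.norm_starProjection_apply_le _ X

/-- **The vertical values are controlled by the horizontal ones.** If `F` is s-holomorphic across
the corners `(v, 0)` (joining the east edge `h = cSrc (v,0)` to the north edge `n = cSrc (v,1)`)
and `(v + e₁, 2)` (joining the north-west edge `w = cSrc (v + e₁, 2)` to `n`), then
`‖F n - F h‖ ≤ ‖F w - F h‖`: the lines of the two corners are orthogonal (Pythagoras,
`norm_projLine_sq_add_two`), the projection of `F n - F h` on the first vanishes and its projection
on the second is that of `F w - F h`. [cite: Smirnov2010, proof of Lemma 3.6 (orthogonality of the lines)] -/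
theorem norm_sub_le_of_isSHolAt {F : MedialVertex → ℂ} {v : Site 2} (h0 : IsSHolAt F (v, 0))
    (h2 : IsSHolAt F (v + cornerUnit 1, 2)) :
    ‖F (cSrc (v, 1)) - F (cSrc (v, 0))‖ ≤ ‖F (cSrc (v + cornerUnit 1, 2)) - F (cSrc (v, 0))‖ := by
  unfold IsSHolAt at h0 h2
  simp only [cFace] at h0 h2
  rw [show cTgt (v, (0 : Fin 4)) = cSrc (v, 1) from rfl] at h0
  have ht2 : cTgt (v + cornerUnit 1, (2 : Fin 4)) = cSrc (v, 1) := by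
    rw [show (2 : Fin 4) = 1 + 1 from rfl, cTgt_add_cornerUnit_succ]
  rw [ht2] at h2
  set n := F (cSrc (v, 1))
  set h := F (cSrc (v, 0))
  set w := F (cSrc (v + cornerUnit 1, 2))
  have pyth := norm_projLine_sq_add_two v (v + cornerUnit 1) 0 (n - h)
  rw [show (0 : Fin 4) + 2 = 2 from rfl] at pyth
  rw [projLine_sub, ← h0, sub_self, norm_zero, projLine_sub, ← h2, ← projLine_sub] at pyth
  simp only [ne_eq, OfNat.ofNat_ne_zero, not_false_eq_true, zero_pow, zero_add] at pyth
  have hle := norm_projLine_le (cornerLine (v + cornerUnit 1) (faceAt (v + cornerUnit 1) 2)) (w - h)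
  have h1 : ‖n - h‖ ^ 2 ≤ ‖w - h‖ ^ 2 := by
    rw [← pyth]; exact pow_le_pow_left₀ (norm_nonneg _) hle 2
  exact (pow_le_pow_iff_left₀ (norm_nonneg _) (norm_nonneg _) two_ne_zero).1 h1

/-! ### The discrete Cauchy theorem on a lattice rectangle -/

section Cauchy

variable (F : MedialVertex → ℂ) (b : Site 2)

/-- The vertex with coordinates `(i, j)` from the base vertex `b`. [folklore] -/
def vtx (i j : ℤ) : Site 2 := b + i • cornerUnit 0 + j • cornerUnit 1

/-- Horizontal edge values indexed from the base vertex `b`: `H(i, j) = F (s(b + (i,j), b + (i+1,j)))`. [folklore] -/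
def hmid (i j : ℤ) : ℂ := edgeFun F 0 (vtx b i j)

/-- Vertical edge values indexed from the base vertex `b`: `V(i, j) = F (s(b + (i,j), b + (i,j+1)))`. [folklore] -/
def vmid (i j : ℤ) : ℂ := edgeFun F 1 (vtx b i j)

/-- The Cauchy–Riemann defect at the vertex `b + (i, j)`:
`V(i,j) - V(i,j-1) - i (H(i,j) - H(i-1,j))` (the contour sum of `F` around the medial square of
the vertex, up to the factor `-1/2`). [cite: Smirnov2010, Remark 3.3] -/
def crDefectVertex (i j : ℤ) : ℂ := vmid F b i j - vmid F b i (j - 1) - I * (hmid F b i j - hmid F b (i - 1) j)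

/-- The Cauchy–Riemann defect at the face with lower-left corner `b + (i, j)`:
`H(i,j+1) - H(i,j) - i (V(i+1,j) - V(i,j))`. [cite: Smirnov2010, Remark 3.3] -/
def crDefectFace (i j : ℤ) : ℂ := hmid F b i (j + 1) - hmid F b i j - I * (vmid F b (i + 1) j - vmid F b i j)

/-- `vtx b i j - e₀ = vtx b (i-1) j`. [folklore] -/
theorem vtx_sub_cornerUnit_zero (i j : ℤ) : vtx b i j - cornerUnit 0 = vtx b (i - 1) j := by
  unfold vtx; rw [sub_smul, one_smul]; abel

/-- `vtx b i j - e₁ = vtx b i (j-1)`. [folklore] -/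
theorem vtx_sub_cornerUnit_one (i j : ℤ) : vtx b i j - cornerUnit 1 = vtx b i (j - 1) := by
  unfold vtx; rw [sub_smul, one_smul]; abel

/-- `vtx b i j + e₀ = vtx b (i+1) j`. [folklore] -/
theorem vtx_add_cornerUnit_zero (i j : ℤ) : vtx b i j + cornerUnit 0 = vtx b (i + 1) j := by
  unfold vtx; rw [add_smul, one_smul]; abel

/-- `vtx b i j + e₁ = vtx b i (j+1)`. [folklore] -/
theorem vtx_add_cornerUnit_one (i j : ℤ) : vtx b i j + cornerUnit 1 = vtx b i (j + 1) := by
  unfold vtx; rw [add_smul, one_smul]; abel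

/-- `CRVertex` at `vtx b i j` is the vanishing of the vertex defect. [cite: Smirnov2010, Remark 3.3] -/
theorem crVertex_iff_defect (i j : ℤ) : CRVertex F (vtx b i j) ↔ crDefectVertex F b i j = 0 := by
  rw [crVertex_iff, crDefectVertex, hmid, hmid, vmid, vmid, vtx_sub_cornerUnit_zero,
    vtx_sub_cornerUnit_one, sub_eq_zero]

/-- `CRFace` at `vtx b i j` is the vanishing of the face defect. [cite: Smirnov2010, Remark 3.3] -/
theorem crFace_iff_defect (i j : ℤ) : CRFace F (vtx b i j) ↔ crDefectFace F b i j = 0 := by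
  rw [crFace_iff, crDefectFace, hmid, hmid, vmid, vmid, vtx_add_cornerUnit_zero,
    vtx_add_cornerUnit_one, sub_eq_zero]

/-- Telescoping over `j = 0, …, n` with integer arguments. [folklore] -/
theorem sum_range_succ_int_sub (g : ℤ → ℂ) (n : ℕ) :
    ∑ j ∈ range (n + 1), (g j - g ((j : ℤ) - 1)) = g n - g (-1) := by
  have := Finset.sum_range_sub (fun j : ℕ => g ((j : ℤ) - 1)) (n + 1)
  simp only [Nat.cast_add, Nat.cast_one, add_sub_cancel_right, Nat.cast_zero, zero_sub] at this
  exact this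

/-- Telescoping over `j = 0, …, n - 1` with integer arguments. [folklore] -/
theorem sum_range_int_succ_sub (g : ℤ → ℂ) (n : ℕ) :
    ∑ j ∈ range n, (g ((j : ℤ) + 1) - g j) = g n - g 0 := by
  have := Finset.sum_range_sub (fun j : ℕ => g j) n
  simp only [Nat.cast_add, Nat.cast_one, Nat.cast_zero] at this
  exact this

/-- **The discrete Green/Cauchy formula on the rectangle `[0, m] × [0, n]` (vertex coordinates
from `b`).** The sum of the Cauchy–Riemann defects over the `(m+1)(n+1)` vertices and the `m n`
faces of the rectangle equals the boundary contour sum of `F` over the medial vertices along the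
four sides — the horizontal edges *on* the bottom/top sides and the vertical edges sticking out of
them, the vertical edges *on* the left/right sides and the horizontal edges sticking out — with
the weights `dz ∈ {1, i, -1, -i}` of the four sides. Holds for every `F` (interior medial edges
cancel in pairs). [cite: Smirnov2010, Remark 3.3] -/
theorem sum_crDefect_eq_boundary (m n : ℕ) :
    (∑ i ∈ range (m + 1), ∑ j ∈ range (n + 1), crDefectVertex F b i j) +
      ∑ i ∈ range m, ∑ j ∈ range n, crDefectFace F b i j =
    (∑ i ∈ range (m + 1), (vmid F b i n - vmid F b i (-1))) +
      (∑ i ∈ range m, (hmid F b i n - hmid F b i 0)) -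
      I * ((∑ j ∈ range (n + 1), (hmid F b m j - hmid F b (-1) j)) +
        ∑ j ∈ range n, (vmid F b m j - vmid F b 0 j)) := by
  -- vertex defects
  have hV : ∑ i ∈ range (m + 1), ∑ j ∈ range (n + 1), crDefectVertex F b i j =
      (∑ i ∈ range (m + 1), (vmid F b i n - vmid F b i (-1))) -
        I * ∑ j ∈ range (n + 1), (hmid F b m j - hmid F b (-1) j) := by
    unfold crDefectVertex
    have e1 : ∀ i ∈ range (m + 1),
        ∑ j ∈ range (n + 1), (vmid F b i j - vmid F b i ((j : ℤ) - 1) - I * (hmid F b i j - hmid F b ((i : ℤ) - 1) j)) =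
        (vmid F b i n - vmid F b i (-1)) - I * ∑ j ∈ range (n + 1), (hmid F b i j - hmid F b ((i : ℤ) - 1) j) := by
      intro i _
      rw [Finset.sum_sub_distrib, sum_range_succ_int_sub (fun j => vmid F b i j) n, Finset.mul_sum]
    rw [Finset.sum_congr rfl e1, Finset.sum_sub_distrib, ← Finset.mul_sum, Finset.sum_comm]
    congr 2
    refine Finset.sum_congr rfl fun j _ => ?_
    exact sum_range_succ_int_sub (fun i => hmid F b i j) m
  -- face defects
  have hF : ∑ i ∈ range m, ∑ j ∈ range n, crDefectFace F b i j =
      (∑ i ∈ range m, (hmid F b i n - hmid F b i 0)) -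
        I * ∑ j ∈ range n, (vmid F b m j - vmid F b 0 j) := by
    unfold crDefectFace
    have e1 : ∀ i ∈ range m,
        ∑ j ∈ range n, (hmid F b i ((j : ℤ) + 1) - hmid F b i j - I * (vmid F b ((i : ℤ) + 1) j - vmid F b i j)) =
        (hmid F b i n - hmid F b i 0) - I * ∑ j ∈ range n, (vmid F b ((i : ℤ) + 1) j - vmid F b i j) := by
      intro i _
      rw [Finset.sum_sub_distrib, sum_range_int_succ_sub (fun j => hmid F b i j) n, Finset.mul_sum]
    rw [Finset.sum_congr rfl e1, Finset.sum_sub_distrib, ← Finset.mul_sum, Finset.sum_comm]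
    congr 2
    refine Finset.sum_congr rfl fun j _ => ?_
    exact sum_range_int_succ_sub (fun i => vmid F b i j) m
  rw [hV, hF]
  ring

/-- **The discrete Cauchy theorem.** If the Cauchy–Riemann equations hold at all vertices
`b + (i, j)`, `0 ≤ i ≤ m`, `0 ≤ j ≤ n`, and at all faces with lower-left corners `b + (i, j)`,
`0 ≤ i < m`, `0 ≤ j < n`, then the boundary contour sum of `F` around the rectangle vanishes.
[cite: Smirnov2010, Remark 3.3] -/
theorem boundary_sum_eq_zero_of_cr (m n : ℕ)
    (hv : ∀ i j : ℕ, i ≤ m → j ≤ n → CRVertex F (vtx b i j))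
    (hf : ∀ i j : ℕ, i < m → j < n → CRFace F (vtx b i j)) :
    (∑ i ∈ range (m + 1), (vmid F b i n - vmid F b i (-1))) +
      (∑ i ∈ range m, (hmid F b i n - hmid F b i 0)) -
      I * ((∑ j ∈ range (n + 1), (hmid F b m j - hmid F b (-1) j)) +
        ∑ j ∈ range n, (vmid F b m j - vmid F b 0 j)) = 0 := by
  rw [← sum_crDefect_eq_boundary]
  have h1 : ∑ i ∈ range (m + 1), ∑ j ∈ range (n + 1), crDefectVertex F b i j = 0 :=
    Finset.sum_eq_zero fun i hi => Finset.sum_eq_zero fun j hj =>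
      (crVertex_iff_defect F b i j).1 (hv i j (Nat.lt_succ_iff.1 (mem_range.1 hi)) (Nat.lt_succ_iff.1 (mem_range.1 hj)))
  have h2 : ∑ i ∈ range m, ∑ j ∈ range n, crDefectFace F b i j = 0 :=
    Finset.sum_eq_zero fun i hi => Finset.sum_eq_zero fun j hj =>
      (crFace_iff_defect F b i j).1 (hf i j (mem_range.1 hi) (mem_range.1 hj))
  rw [h1, h2, add_zero]

end Cauchy

end Literature.Probability.LatticeModels
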